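import Mathlib.Analysis.InnerProductSpace.PiL2
import Mathlib.MeasureTheory.Function.L2Space
import Mathlib.MeasureTheory.Integral.Bochner.Basic
import Mathlib.MeasureTheory.Measure.Haar.InnerProductSpace
import Mathlib.Analysis.SpecialFunctions.Pow.Real
import Mathlib.Analysis.SpecialFunctions.Sqrt
import Mathlib.Analysis.SpecialFunctions.Trigonometric.Basic
import HarnessLib

/-!
# Crux `BlockLipschitzL` (stmt-QuantumFields-23533) ∕ `HistoryTailL` (stmt-QuantumFields-19936), LINE 25 «CompactnessTransfer»,
# stub S1″ — the (GAP) socket, ROAD (W) «Wente at 3π», brick (W-ALG), FILE 1∕2: LETTERS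

Cell `ym3-torus` (YM ladder rung R3 = continuum SU(2) Yang–Mills on T³ — a RUNG, NOT Clay: not d = 4, not infinite volume,
not a mass gap); WIDTH helper seat `ym-ust-19936-w3` g16; `--supports stmt-QuantumFields-23533`; THEOREMS ONLY (0 `def`,
0 `sorry`, default heartbeats); imports Mathlib only.  See FILE 2∕2 `…PoincareLipschitzHSystemGapAlgebra` for the road and the
main theorem; this file holds its letters (letters: `E² = EuclideanSpace ℝ (Fin 2)`, `E³ = EuclideanSpace ℝ (Fin 3)`,
`e k = EuclideanSpace.single k 1`, `∂_k B^a := (GB y (e k)) a`, Jacobian densities `f_{jk} := ∂₀B^j ∂₁B^k − ∂₀B^k ∂₁B^j`):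
* §1 pointwise algebra in `ℝ²`: Lagrange's identity `det² + dot² = |p|²|q|²`, Hadamard `|det(p,q)| ≤ |p||q|`, its equality case
  `⇒ p·q = 0`, ★`sq_norm_eq_zero_of_three_orthogonal` (the Gram determinant of three vectors of `ℝ²` vanishes identically, so
  three pairwise-orthogonal vectors of equal length are `0`), and the AM–GM pair-sum inequality with its equality case.
* §2 ★`integral_mul_le_sqrt_mul_sqrt` — Cauchy–Schwarz for two nonnegative functions with integrable squares (Mathlib's Hölder).
* §3 letters for a measurable Jacobian field `GB : E² → (E² →L[ℝ] E³)` with integrable energy density `Σ_k ‖GB e_k‖²`: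
  measurability∕integrability of components, `∫Σ_k‖GB e_k‖² = Σ_a ‖∇B^a‖₂²`, ★`integral_gradNorm_mul_le` (`∫|∇B^j||∇B^k| ≤
  ‖∇B^j‖₂‖∇B^k‖₂`), Hadamard for `f_{jk}`, ★`abs_integral_osc_mul_det_le` (`|B^a − c| ≤ κ` a.e. ⇒ `|∫(B^a − c) f_{jk}| ≤ κ∫|f_{jk}|`),
  and the two a.e. EQUALITY CASES ★`ae_abs_det_eq_of_integral_eq` (Hadamard) and ★`ae_gradNorm_eq_of_integral_eq` (Cauchy–Schwarz).
HONEST SCOPE.  Real analysis on `ℝ²` only; nothing of (GAP), (TM), S1″, K1, `BlockLipschitzL`, `HistoryTailL` is proved here.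
YM₃ on T³ is rung R3, not Clay; YM gap NOT proved; no summit statement is proved here.

References: P. Topping, Comment. Math. Helv. 72 (1997) [Topping1997]; H. Brezis, J.-M. Coron, ARMA 89 (1985) [BrezisCoron1985].
-/

set_option autoImplicit false

noncomputable section

open MeasureTheory Set Function Filter Topology
open scoped ENNReal BigOperators

namespace Summit.QuantumFields.YangMills.Theorems.PoincareLipschitzHSystemGapAlgebraLetters

/-! ## §1 Pointwise algebra in `ℝ²` -/

/-- Lagrange's identity in `ℝ²`: `det(p,q)² + (p·q)² = |p|²|q|²`. [folklore] -/
theorem det_sq_add_dot_sq (p0 p1 q0 q1 : ℝ) :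
    (p0 * q1 - q0 * p1) ^ 2 + (p0 * q0 + p1 * q1) ^ 2 = (p0 ^ 2 + p1 ^ 2) * (q0 ^ 2 + q1 ^ 2) := by
  ring

/-- Hadamard's inequality in `ℝ²`: `|det(p,q)| ≤ |p| |q|`. [folklore] -/
theorem abs_det_le_sqrt_mul_sqrt (p0 p1 q0 q1 : ℝ) :
    |p0 * q1 - q0 * p1| ≤ Real.sqrt (p0 ^ 2 + p1 ^ 2) * Real.sqrt (q0 ^ 2 + q1 ^ 2) := by
  rw [← Real.sqrt_mul (by positivity), ← Real.sqrt_sq_eq_abs]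
  exact Real.sqrt_le_sqrt (by nlinarith [det_sq_add_dot_sq p0 p1 q0 q1, sq_nonneg (p0 * q0 + p1 * q1)])

/-- Equality in Hadamard's inequality forces orthogonality: `|det(p,q)| = |p||q| ⇒ p·q = 0`. [folklore] -/
theorem dot_eq_zero_of_abs_det_eq (p0 p1 q0 q1 : ℝ)
    (h : |p0 * q1 - q0 * p1| = Real.sqrt (p0 ^ 2 + p1 ^ 2) * Real.sqrt (q0 ^ 2 + q1 ^ 2)) :
    p0 * q0 + p1 * q1 = 0 := by
  have h2 : (p0 * q1 - q0 * p1) ^ 2 = (p0 ^ 2 + p1 ^ 2) * (q0 ^ 2 + q1 ^ 2) := by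
    have hsq : |p0 * q1 - q0 * p1| ^ 2 = (Real.sqrt (p0 ^ 2 + p1 ^ 2) * Real.sqrt (q0 ^ 2 + q1 ^ 2)) ^ 2 := by rw [h]
    rw [sq_abs, mul_pow, Real.sq_sqrt (by positivity), Real.sq_sqrt (by positivity)] at hsq
    exact hsq
  have h3 : (p0 * q0 + p1 * q1) ^ 2 = 0 := by linarith [det_sq_add_dot_sq p0 p1 q0 q1]
  exact pow_eq_zero_iff (two_ne_zero) |>.mp h3

/-- **Three pairwise-orthogonal vectors of equal length in `ℝ²` vanish**: the Gram determinant of three vectors of `ℝ²` is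
identically zero, and under the hypotheses it equals `|p|⁶`. [folklore] -/
theorem sq_norm_eq_zero_of_three_orthogonal (p0 p1 q0 q1 r0 r1 : ℝ)
    (hpq : p0 * q0 + p1 * q1 = 0) (hqr : q0 * r0 + q1 * r1 = 0) (hrp : r0 * p0 + r1 * p1 = 0)
    (hq : q0 ^ 2 + q1 ^ 2 = p0 ^ 2 + p1 ^ 2) (hr : r0 ^ 2 + r1 ^ 2 = p0 ^ 2 + p1 ^ 2) :
    p0 ^ 2 + p1 ^ 2 = 0 := by
  have gram : (p0 ^ 2 + p1 ^ 2) * (q0 ^ 2 + q1 ^ 2) * (r0 ^ 2 + r1 ^ 2)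
      + 2 * (p0 * q0 + p1 * q1) * (q0 * r0 + q1 * r1) * (r0 * p0 + r1 * p1)
      - (p0 ^ 2 + p1 ^ 2) * (q0 * r0 + q1 * r1) ^ 2 - (q0 ^ 2 + q1 ^ 2) * (r0 * p0 + r1 * p1) ^ 2
      - (r0 ^ 2 + r1 ^ 2) * (p0 * q0 + p1 * q1) ^ 2 = 0 := by
    ring
  rw [hpq, hqr, hrp, hq, hr] at gram
  have h3 : (p0 ^ 2 + p1 ^ 2) ^ 3 = 0 := by nlinarith [gram]
  exact pow_eq_zero_iff (by norm_num : (3 : ℕ) ≠ 0) |>.mp h3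

/-- AM–GM for the three pair products: `3(xy + yz + zx) ≤ (x + y + z)²`. [folklore] -/
theorem three_mul_pair_sum_le_sq (x y z : ℝ) : 3 * (y * z + z * x + x * y) ≤ (x + y + z) ^ 2 := by
  nlinarith [sq_nonneg (x - y), sq_nonneg (y - z), sq_nonneg (z - x)]

/-- Equality in `3(xy + yz + zx) ≤ (x + y + z)²` forces `x = y = z`. [folklore] -/
theorem eq_of_three_mul_pair_sum_eq_sq (x y z : ℝ) (h : 3 * (y * z + z * x + x * y) = (x + y + z) ^ 2) :
    x = y ∧ y = z := by
  have h0 : (x - y) ^ 2 + (y - z) ^ 2 + (z - x) ^ 2 = 0 := by nlinarith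
  have hxy : (x - y) ^ 2 = 0 := by nlinarith [sq_nonneg (x - y), sq_nonneg (y - z), sq_nonneg (z - x)]
  have hyz : (y - z) ^ 2 = 0 := by nlinarith [sq_nonneg (x - y), sq_nonneg (y - z), sq_nonneg (z - x)]
  refine ⟨?_, ?_⟩
  · have := pow_eq_zero_iff (two_ne_zero) |>.mp hxy; linarith
  · have := pow_eq_zero_iff (two_ne_zero) |>.mp hyz; linarith

/-! ## §2 Integrability letters and Cauchy–Schwarz -/

/-- **Cauchy–Schwarz for two nonnegative functions with integrable squares**:
`∫ u v ≤ √(∫ u²) · √(∫ v²)`. [folklore] -/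
theorem integral_mul_le_sqrt_mul_sqrt {α : Type*} [MeasurableSpace α] {μ : Measure α} {u v : α → ℝ}
    (hu0 : ∀ x, 0 ≤ u x) (hv0 : ∀ x, 0 ≤ v x) (hum : AEStronglyMeasurable u μ) (hvm : AEStronglyMeasurable v μ)
    (hu2 : Integrable (fun x => u x ^ 2) μ) (hv2 : Integrable (fun x => v x ^ 2) μ) :
    ∫ x, u x * v x ∂μ ≤ Real.sqrt (∫ x, u x ^ 2 ∂μ) * Real.sqrt (∫ x, v x ^ 2 ∂μ) := by
  have hu : MemLp u 2 μ := (memLp_two_iff_integrable_sq hum).mpr hu2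
  have hv : MemLp v 2 μ := (memLp_two_iff_integrable_sq hvm).mpr hv2
  have h := integral_mul_le_Lp_mul_Lq_of_nonneg (μ := μ) Real.HolderConjugate.two_two
    (Eventually.of_forall hu0) (Eventually.of_forall hv0) (by simpa using hu) (by simpa using hv)
  have e1 : (∫ x, u x ^ (2 : ℝ) ∂μ) = ∫ x, u x ^ 2 ∂μ := by
    refine integral_congr_ae (Eventually.of_forall fun x => ?_); simp
  have e2 : (∫ x, v x ^ (2 : ℝ) ∂μ) = ∫ x, v x ^ 2 ∂μ := by
    refine integral_congr_ae (Eventually.of_forall fun x => ?_); simp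
  rw [e1, e2] at h
  simpa [Real.sqrt_eq_rpow, one_div] using h

/-! ## §3 Letters for an `L²` Jacobian field on `ℝ²` (components, energies, Jacobian densities) -/

/-- Index letters in `Fin 3`. [folklore] -/
theorem fin3_zero_add_one : ((0 : Fin 3) + 1) = 1 := rfl
/-- Index letters in `Fin 3`. [folklore] -/
theorem fin3_zero_add_two : ((0 : Fin 3) + 2) = 2 := rfl
/-- Index letters in `Fin 3`. [folklore] -/
theorem fin3_one_add_one : ((1 : Fin 3) + 1) = 2 := rfl
/-- Index letters in `Fin 3`. [folklore] -/
theorem fin3_one_add_two : ((1 : Fin 3) + 2) = 0 := rfl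
/-- Index letters in `Fin 3`. [folklore] -/
theorem fin3_two_add_one : ((2 : Fin 3) + 1) = 0 := rfl
/-- Index letters in `Fin 3`. [folklore] -/
theorem fin3_two_add_two : ((2 : Fin 3) + 2) = 1 := rfl

/-- The squared norm of a vector of `E³ = EuclideanSpace ℝ (Fin 3)` is the sum of the squares of its coordinates. [folklore] -/
theorem norm_sq_eq_sum_sq_fin_three (v : EuclideanSpace ℝ (Fin 3)) : ‖v‖ ^ 2 = ∑ a : Fin 3, (v a) ^ 2 := by
  rw [EuclideanSpace.norm_sq_eq]
  exact Finset.sum_congr rfl (fun a _ => by rw [Real.norm_eq_abs, sq_abs])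

section Letters

variable {B : EuclideanSpace ℝ (Fin 2) → EuclideanSpace ℝ (Fin 3)}
  {GB : EuclideanSpace ℝ (Fin 2) → (EuclideanSpace ℝ (Fin 2) →L[ℝ] EuclideanSpace ℝ (Fin 3))}

/-- Measurability of the component `∂_k B^a = (GB y (e k)) a` of a measurable Jacobian field. [folklore] -/
theorem aestronglyMeasurable_comp (hGm : AEStronglyMeasurable GB volume) (a : Fin 3) (k : Fin 2) :
    AEStronglyMeasurable (fun y => (GB y (EuclideanSpace.single k (1:ℝ))) a) volume := by
  have h1 : AEStronglyMeasurable (fun y => GB y (EuclideanSpace.single k (1:ℝ))) volume :=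
    (ContinuousLinearMap.apply ℝ (EuclideanSpace ℝ (Fin 3)) (EuclideanSpace.single k (1:ℝ))).continuous.comp_aestronglyMeasurable hGm
  exact (EuclideanSpace.proj a : EuclideanSpace ℝ (Fin 3) →L[ℝ] ℝ).continuous.comp_aestronglyMeasurable h1

/-- A squared component `(∂_k B^a)²` is dominated by the energy density, hence integrable. [folklore] -/
theorem integrable_comp_sq (hGm : AEStronglyMeasurable GB volume)
    (hE : Integrable (fun y => ∑ k : Fin 2, ‖GB y (EuclideanSpace.single k (1:ℝ))‖ ^ 2)) (a : Fin 3) (k : Fin 2) :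
    Integrable (fun y => ((GB y (EuclideanSpace.single k (1:ℝ))) a) ^ 2) := by
  refine hE.mono' ((aestronglyMeasurable_comp hGm a k).pow 2) (Eventually.of_forall fun y => ?_)
  rw [Real.norm_eq_abs, abs_of_nonneg (sq_nonneg _)]
  calc ((GB y (EuclideanSpace.single k (1:ℝ))) a) ^ 2 ≤ ‖GB y (EuclideanSpace.single k (1:ℝ))‖ ^ 2 := by
          rw [norm_sq_eq_sum_sq_fin_three]
          exact Finset.single_le_sum (fun b _ => sq_nonneg ((GB y (EuclideanSpace.single k (1:ℝ))) b)) (Finset.mem_univ a)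
    _ ≤ ∑ k' : Fin 2, ‖GB y (EuclideanSpace.single k' (1:ℝ))‖ ^ 2 :=
          Finset.single_le_sum (fun k' _ => sq_nonneg ‖GB y (EuclideanSpace.single k' (1:ℝ))‖) (Finset.mem_univ k)

/-- The squared gradient length `|∇B^a|² = Σ_k (∂_k B^a)²` is integrable. [folklore] -/
theorem integrable_gradSq (hGm : AEStronglyMeasurable GB volume)
    (hE : Integrable (fun y => ∑ k : Fin 2, ‖GB y (EuclideanSpace.single k (1:ℝ))‖ ^ 2)) (a : Fin 3) :
    Integrable (fun y => ∑ k : Fin 2, ((GB y (EuclideanSpace.single k (1:ℝ))) a) ^ 2) :=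
  integrable_finsetSum _ (fun k _ => integrable_comp_sq hGm hE a k)

/-- Component energies are nonnegative. [folklore] -/
theorem gradEnergy_nonneg (GB : EuclideanSpace ℝ (Fin 2) → (EuclideanSpace ℝ (Fin 2) →L[ℝ] EuclideanSpace ℝ (Fin 3))) (a : Fin 3) :
    0 ≤ ∫ y, ∑ k : Fin 2, ((GB y (EuclideanSpace.single k (1:ℝ))) a) ^ 2 :=
  integral_nonneg (fun _ => Finset.sum_nonneg (fun _ _ => sq_nonneg _))

/-- **The energy is the sum of the three component energies**: `∫ Σ_k ‖GB e_k‖² = Σ_a ∫ Σ_k (∂_k B^a)²`. [folklore] -/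
theorem energy_eq_sum_gradEnergy (hGm : AEStronglyMeasurable GB volume)
    (hE : Integrable (fun y => ∑ k : Fin 2, ‖GB y (EuclideanSpace.single k (1:ℝ))‖ ^ 2)) :
    ∫ y, ∑ k : Fin 2, ‖GB y (EuclideanSpace.single k (1:ℝ))‖ ^ 2 =
      (∫ y, ∑ k : Fin 2, ((GB y (EuclideanSpace.single k (1:ℝ))) 0) ^ 2) +
      (∫ y, ∑ k : Fin 2, ((GB y (EuclideanSpace.single k (1:ℝ))) 1) ^ 2) +
      (∫ y, ∑ k : Fin 2, ((GB y (EuclideanSpace.single k (1:ℝ))) 2) ^ 2) := by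
  have hfun : (fun y : EuclideanSpace ℝ (Fin 2) => ∑ k : Fin 2, ‖GB y (EuclideanSpace.single k (1:ℝ))‖ ^ 2) =
      fun y => ∑ a : Fin 3, ∑ k : Fin 2, ((GB y (EuclideanSpace.single k (1:ℝ))) a) ^ 2 := by
    funext y
    rw [Finset.sum_comm]
    exact Finset.sum_congr rfl (fun k _ => norm_sq_eq_sum_sq_fin_three _)
  rw [hfun, integral_finsetSum _ (fun a _ => integrable_gradSq hGm hE a)]
  simp only [Fin.sum_univ_three]

/-- Measurability of the gradient length `|∇B^a| = √(Σ_k (∂_k B^a)²)`. [folklore] -/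
theorem aestronglyMeasurable_gradNorm (hGm : AEStronglyMeasurable GB volume)
    (hE : Integrable (fun y => ∑ k : Fin 2, ‖GB y (EuclideanSpace.single k (1:ℝ))‖ ^ 2)) (a : Fin 3) :
    AEStronglyMeasurable (fun y => Real.sqrt (∑ k : Fin 2, ((GB y (EuclideanSpace.single k (1:ℝ))) a) ^ 2)) volume :=
  Real.continuous_sqrt.comp_aestronglyMeasurable (integrable_gradSq hGm hE a).aestronglyMeasurable

/-- The product of two gradient lengths `|∇B^j| |∇B^k|` is integrable. [folklore] -/
theorem integrable_gradNorm_mul (hGm : AEStronglyMeasurable GB volume)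
    (hE : Integrable (fun y => ∑ k : Fin 2, ‖GB y (EuclideanSpace.single k (1:ℝ))‖ ^ 2)) (j k : Fin 3) :
    Integrable (fun y => Real.sqrt (∑ i : Fin 2, ((GB y (EuclideanSpace.single i (1:ℝ))) j) ^ 2) *
      Real.sqrt (∑ i : Fin 2, ((GB y (EuclideanSpace.single i (1:ℝ))) k) ^ 2)) := by
  have hsum : Integrable (fun y => (∑ i : Fin 2, ((GB y (EuclideanSpace.single i (1:ℝ))) j) ^ 2) +
      (∑ i : Fin 2, ((GB y (EuclideanSpace.single i (1:ℝ))) k) ^ 2)) :=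
    (integrable_gradSq hGm hE j).add (integrable_gradSq hGm hE k)
  refine hsum.mono' ((aestronglyMeasurable_gradNorm hGm hE j).mul (aestronglyMeasurable_gradNorm hGm hE k))
    (Eventually.of_forall fun y => ?_)
  have hp := Finset.sum_nonneg (fun i (_ : i ∈ Finset.univ) => sq_nonneg ((GB y (EuclideanSpace.single i (1:ℝ))) j))
  have hq := Finset.sum_nonneg (fun i (_ : i ∈ Finset.univ) => sq_nonneg ((GB y (EuclideanSpace.single i (1:ℝ))) k))
  rw [Real.norm_eq_abs, abs_of_nonneg (mul_nonneg (Real.sqrt_nonneg _) (Real.sqrt_nonneg _))]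
  nlinarith [sq_nonneg (Real.sqrt (∑ i : Fin 2, ((GB y (EuclideanSpace.single i (1:ℝ))) j) ^ 2) -
      Real.sqrt (∑ i : Fin 2, ((GB y (EuclideanSpace.single i (1:ℝ))) k) ^ 2)),
    Real.sq_sqrt hp, Real.sq_sqrt hq,
    mul_nonneg (Real.sqrt_nonneg (∑ i : Fin 2, ((GB y (EuclideanSpace.single i (1:ℝ))) j) ^ 2))
      (Real.sqrt_nonneg (∑ i : Fin 2, ((GB y (EuclideanSpace.single i (1:ℝ))) k) ^ 2))]

/-- **Cauchy–Schwarz for the gradient lengths**: `∫ |∇B^j| |∇B^k| ≤ ‖∇B^j‖₂ ‖∇B^k‖₂`. [folklore] -/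
theorem integral_gradNorm_mul_le (hGm : AEStronglyMeasurable GB volume)
    (hE : Integrable (fun y => ∑ k : Fin 2, ‖GB y (EuclideanSpace.single k (1:ℝ))‖ ^ 2)) (j k : Fin 3) :
    ∫ y, Real.sqrt (∑ i : Fin 2, ((GB y (EuclideanSpace.single i (1:ℝ))) j) ^ 2) *
        Real.sqrt (∑ i : Fin 2, ((GB y (EuclideanSpace.single i (1:ℝ))) k) ^ 2) ≤
      Real.sqrt (∫ y, ∑ i : Fin 2, ((GB y (EuclideanSpace.single i (1:ℝ))) j) ^ 2) *
      Real.sqrt (∫ y, ∑ i : Fin 2, ((GB y (EuclideanSpace.single i (1:ℝ))) k) ^ 2) := by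
  have hsq : ∀ (a : Fin 3) (y : EuclideanSpace ℝ (Fin 2)),
      Real.sqrt (∑ i : Fin 2, ((GB y (EuclideanSpace.single i (1:ℝ))) a) ^ 2) ^ 2 =
        ∑ i : Fin 2, ((GB y (EuclideanSpace.single i (1:ℝ))) a) ^ 2 := fun a y =>
    Real.sq_sqrt (Finset.sum_nonneg (fun i _ => sq_nonneg _))
  have h := integral_mul_le_sqrt_mul_sqrt (μ := volume) (fun y => Real.sqrt_nonneg _) (fun y => Real.sqrt_nonneg _)
    (aestronglyMeasurable_gradNorm hGm hE j) (aestronglyMeasurable_gradNorm hGm hE k)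
    (by simpa only [hsq] using integrable_gradSq hGm hE j) (by simpa only [hsq] using integrable_gradSq hGm hE k)
  simpa only [hsq] using h

/-- **Hadamard for the Jacobian density**: `|∂₀B^j ∂₁B^k − ∂₀B^k ∂₁B^j| ≤ |∇B^j| |∇B^k|` pointwise. [folklore] -/
theorem abs_det_le_gradNorm_mul (GB : EuclideanSpace ℝ (Fin 2) → (EuclideanSpace ℝ (Fin 2) →L[ℝ] EuclideanSpace ℝ (Fin 3)))
    (j k : Fin 3) (y : EuclideanSpace ℝ (Fin 2)) :
    |(GB y (EuclideanSpace.single 0 (1:ℝ))) j * (GB y (EuclideanSpace.single 1 (1:ℝ))) k -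
        (GB y (EuclideanSpace.single 0 (1:ℝ))) k * (GB y (EuclideanSpace.single 1 (1:ℝ))) j| ≤
      Real.sqrt (∑ i : Fin 2, ((GB y (EuclideanSpace.single i (1:ℝ))) j) ^ 2) *
      Real.sqrt (∑ i : Fin 2, ((GB y (EuclideanSpace.single i (1:ℝ))) k) ^ 2) := by
  simp only [Fin.sum_univ_two]
  exact abs_det_le_sqrt_mul_sqrt _ _ _ _

/-- Measurability of the Jacobian density `∂₀B^j ∂₁B^k − ∂₀B^k ∂₁B^j`. [folklore] -/
theorem aestronglyMeasurable_det (hGm : AEStronglyMeasurable GB volume) (j k : Fin 3) :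
    AEStronglyMeasurable (fun y => (GB y (EuclideanSpace.single 0 (1:ℝ))) j * (GB y (EuclideanSpace.single 1 (1:ℝ))) k -
        (GB y (EuclideanSpace.single 0 (1:ℝ))) k * (GB y (EuclideanSpace.single 1 (1:ℝ))) j) volume :=
  ((aestronglyMeasurable_comp hGm j 0).mul (aestronglyMeasurable_comp hGm k 1)).sub
    ((aestronglyMeasurable_comp hGm k 0).mul (aestronglyMeasurable_comp hGm j 1))

/-- The Jacobian density is absolutely integrable. [folklore] -/
theorem integrable_abs_det (hGm : AEStronglyMeasurable GB volume)
    (hE : Integrable (fun y => ∑ k : Fin 2, ‖GB y (EuclideanSpace.single k (1:ℝ))‖ ^ 2)) (j k : Fin 3) :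
    Integrable (fun y => |(GB y (EuclideanSpace.single 0 (1:ℝ))) j * (GB y (EuclideanSpace.single 1 (1:ℝ))) k -
        (GB y (EuclideanSpace.single 0 (1:ℝ))) k * (GB y (EuclideanSpace.single 1 (1:ℝ))) j|) :=
  (integrable_gradNorm_mul hGm hE j k).mono' (continuous_abs.comp_aestronglyMeasurable (aestronglyMeasurable_det hGm j k))
    (Eventually.of_forall fun y => by rw [Real.norm_eq_abs, abs_abs]; exact abs_det_le_gradNorm_mul GB j k y)

/-- `∫ |f_{jk}| ≤ ∫ |∇B^j| |∇B^k|`. [folklore] -/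
theorem integral_abs_det_le (hGm : AEStronglyMeasurable GB volume)
    (hE : Integrable (fun y => ∑ k : Fin 2, ‖GB y (EuclideanSpace.single k (1:ℝ))‖ ^ 2)) (j k : Fin 3) :
    ∫ y, |(GB y (EuclideanSpace.single 0 (1:ℝ))) j * (GB y (EuclideanSpace.single 1 (1:ℝ))) k -
        (GB y (EuclideanSpace.single 0 (1:ℝ))) k * (GB y (EuclideanSpace.single 1 (1:ℝ))) j| ≤
      ∫ y, Real.sqrt (∑ i : Fin 2, ((GB y (EuclideanSpace.single i (1:ℝ))) j) ^ 2) *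
        Real.sqrt (∑ i : Fin 2, ((GB y (EuclideanSpace.single i (1:ℝ))) k) ^ 2) :=
  integral_mono_of_nonneg (Eventually.of_forall fun _ => abs_nonneg _) (integrable_gradNorm_mul hGm hE j k)
    (Eventually.of_forall fun y => abs_det_le_gradNorm_mul GB j k y)

/-- **The oscillation row bounds each tested term**: if `|B^a − c| ≤ κ` a.e. then
`|∫ (B^a − c) f_{jk}| ≤ κ ∫ |f_{jk}|`. [folklore] -/
theorem abs_integral_osc_mul_det_le (hGm : AEStronglyMeasurable GB volume)
    (hE : Integrable (fun y => ∑ k : Fin 2, ‖GB y (EuclideanSpace.single k (1:ℝ))‖ ^ 2)) (a j k : Fin 3) {c κ : ℝ}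
    (hosc : ∀ᵐ y : EuclideanSpace ℝ (Fin 2), |B y a - c| ≤ κ) :
    |∫ y, (B y a - c) * ((GB y (EuclideanSpace.single 0 (1:ℝ))) j * (GB y (EuclideanSpace.single 1 (1:ℝ))) k -
        (GB y (EuclideanSpace.single 0 (1:ℝ))) k * (GB y (EuclideanSpace.single 1 (1:ℝ))) j)| ≤
      κ * ∫ y, |(GB y (EuclideanSpace.single 0 (1:ℝ))) j * (GB y (EuclideanSpace.single 1 (1:ℝ))) k -
        (GB y (EuclideanSpace.single 0 (1:ℝ))) k * (GB y (EuclideanSpace.single 1 (1:ℝ))) j| := by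
  calc |∫ y, (B y a - c) * ((GB y (EuclideanSpace.single 0 (1:ℝ))) j * (GB y (EuclideanSpace.single 1 (1:ℝ))) k -
        (GB y (EuclideanSpace.single 0 (1:ℝ))) k * (GB y (EuclideanSpace.single 1 (1:ℝ))) j)|
      ≤ ∫ y, |(B y a - c) * ((GB y (EuclideanSpace.single 0 (1:ℝ))) j * (GB y (EuclideanSpace.single 1 (1:ℝ))) k -
        (GB y (EuclideanSpace.single 0 (1:ℝ))) k * (GB y (EuclideanSpace.single 1 (1:ℝ))) j)| := abs_integral_le_integral_abs
    _ ≤ ∫ y, κ * |(GB y (EuclideanSpace.single 0 (1:ℝ))) j * (GB y (EuclideanSpace.single 1 (1:ℝ))) k -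
        (GB y (EuclideanSpace.single 0 (1:ℝ))) k * (GB y (EuclideanSpace.single 1 (1:ℝ))) j| := by
        refine integral_mono_of_nonneg (Eventually.of_forall fun _ => abs_nonneg _) ((integrable_abs_det hGm hE j k).const_mul κ) ?_
        filter_upwards [hosc] with y hy
        rw [abs_mul]
        exact mul_le_mul_of_nonneg_right hy (abs_nonneg _)
    _ = κ * ∫ y, |(GB y (EuclideanSpace.single 0 (1:ℝ))) j * (GB y (EuclideanSpace.single 1 (1:ℝ))) k -
        (GB y (EuclideanSpace.single 0 (1:ℝ))) k * (GB y (EuclideanSpace.single 1 (1:ℝ))) j| := integral_const_mul _ _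

/-- **Equality case of Hadamard, a.e.**: if `∫ |f_{jk}| = ∫ |∇B^j||∇B^k|` then `|f_{jk}| = |∇B^j||∇B^k|` a.e. [folklore] -/
theorem ae_abs_det_eq_of_integral_eq (hGm : AEStronglyMeasurable GB volume)
    (hE : Integrable (fun y => ∑ k : Fin 2, ‖GB y (EuclideanSpace.single k (1:ℝ))‖ ^ 2)) (j k : Fin 3)
    (h : ∫ y, |(GB y (EuclideanSpace.single 0 (1:ℝ))) j * (GB y (EuclideanSpace.single 1 (1:ℝ))) k -
        (GB y (EuclideanSpace.single 0 (1:ℝ))) k * (GB y (EuclideanSpace.single 1 (1:ℝ))) j| =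
      ∫ y, Real.sqrt (∑ i : Fin 2, ((GB y (EuclideanSpace.single i (1:ℝ))) j) ^ 2) *
        Real.sqrt (∑ i : Fin 2, ((GB y (EuclideanSpace.single i (1:ℝ))) k) ^ 2)) :
    ∀ᵐ y : EuclideanSpace ℝ (Fin 2), |(GB y (EuclideanSpace.single 0 (1:ℝ))) j * (GB y (EuclideanSpace.single 1 (1:ℝ))) k -
        (GB y (EuclideanSpace.single 0 (1:ℝ))) k * (GB y (EuclideanSpace.single 1 (1:ℝ))) j| =
      Real.sqrt (∑ i : Fin 2, ((GB y (EuclideanSpace.single i (1:ℝ))) j) ^ 2) *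
        Real.sqrt (∑ i : Fin 2, ((GB y (EuclideanSpace.single i (1:ℝ))) k) ^ 2) := by
  have hint := (integrable_gradNorm_mul hGm hE j k).sub (integrable_abs_det hGm hE j k)
  have hzero : ∫ y, (Real.sqrt (∑ i : Fin 2, ((GB y (EuclideanSpace.single i (1:ℝ))) j) ^ 2) *
        Real.sqrt (∑ i : Fin 2, ((GB y (EuclideanSpace.single i (1:ℝ))) k) ^ 2) -
      |(GB y (EuclideanSpace.single 0 (1:ℝ))) j * (GB y (EuclideanSpace.single 1 (1:ℝ))) k -
        (GB y (EuclideanSpace.single 0 (1:ℝ))) k * (GB y (EuclideanSpace.single 1 (1:ℝ))) j|) = 0 := by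
    rw [integral_sub (integrable_gradNorm_mul hGm hE j k) (integrable_abs_det hGm hE j k), h, sub_self]
  have hnn : 0 ≤ᵐ[volume] fun y => Real.sqrt (∑ i : Fin 2, ((GB y (EuclideanSpace.single i (1:ℝ))) j) ^ 2) *
        Real.sqrt (∑ i : Fin 2, ((GB y (EuclideanSpace.single i (1:ℝ))) k) ^ 2) -
      |(GB y (EuclideanSpace.single 0 (1:ℝ))) j * (GB y (EuclideanSpace.single 1 (1:ℝ))) k -
        (GB y (EuclideanSpace.single 0 (1:ℝ))) k * (GB y (EuclideanSpace.single 1 (1:ℝ))) j| :=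
    Eventually.of_forall fun y => sub_nonneg.mpr (abs_det_le_gradNorm_mul GB j k y)
  have hae := (integral_eq_zero_iff_of_nonneg_ae hnn hint).mp hzero
  filter_upwards [hae] with y hy
  have hy' : Real.sqrt (∑ i : Fin 2, ((GB y (EuclideanSpace.single i (1:ℝ))) j) ^ 2) *
        Real.sqrt (∑ i : Fin 2, ((GB y (EuclideanSpace.single i (1:ℝ))) k) ^ 2) -
      |(GB y (EuclideanSpace.single 0 (1:ℝ))) j * (GB y (EuclideanSpace.single 1 (1:ℝ))) k -
        (GB y (EuclideanSpace.single 0 (1:ℝ))) k * (GB y (EuclideanSpace.single 1 (1:ℝ))) j| = 0 := hy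
  linarith

/-- **Equality case of Cauchy–Schwarz, a.e.**: if `‖∇B^j‖₂² = ‖∇B^k‖₂² = t` and `∫|∇B^j||∇B^k| = t` then
`|∇B^j| = |∇B^k|` a.e. (`∫ (|∇B^j| − |∇B^k|)² = 0`). [folklore] -/
theorem ae_gradNorm_eq_of_integral_eq (hGm : AEStronglyMeasurable GB volume)
    (hE : Integrable (fun y => ∑ k : Fin 2, ‖GB y (EuclideanSpace.single k (1:ℝ))‖ ^ 2)) (j k : Fin 3) {t : ℝ}
    (hj : ∫ y, ∑ i : Fin 2, ((GB y (EuclideanSpace.single i (1:ℝ))) j) ^ 2 = t)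
    (hk : ∫ y, ∑ i : Fin 2, ((GB y (EuclideanSpace.single i (1:ℝ))) k) ^ 2 = t)
    (h : ∫ y, Real.sqrt (∑ i : Fin 2, ((GB y (EuclideanSpace.single i (1:ℝ))) j) ^ 2) *
        Real.sqrt (∑ i : Fin 2, ((GB y (EuclideanSpace.single i (1:ℝ))) k) ^ 2) = t) :
    ∀ᵐ y : EuclideanSpace ℝ (Fin 2), Real.sqrt (∑ i : Fin 2, ((GB y (EuclideanSpace.single i (1:ℝ))) j) ^ 2) =
      Real.sqrt (∑ i : Fin 2, ((GB y (EuclideanSpace.single i (1:ℝ))) k) ^ 2) := by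
  have hsq : ∀ (a : Fin 3) (y : EuclideanSpace ℝ (Fin 2)),
      Real.sqrt (∑ i : Fin 2, ((GB y (EuclideanSpace.single i (1:ℝ))) a) ^ 2) ^ 2 =
        ∑ i : Fin 2, ((GB y (EuclideanSpace.single i (1:ℝ))) a) ^ 2 := fun a y =>
    Real.sq_sqrt (Finset.sum_nonneg (fun i _ => sq_nonneg _))
  have hNj : Integrable (fun y => Real.sqrt (∑ i : Fin 2, ((GB y (EuclideanSpace.single i (1:ℝ))) j) ^ 2) ^ 2) := by
    simpa only [hsq] using integrable_gradSq hGm hE j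
  have hNk : Integrable (fun y => Real.sqrt (∑ i : Fin 2, ((GB y (EuclideanSpace.single i (1:ℝ))) k) ^ 2) ^ 2) := by
    simpa only [hsq] using integrable_gradSq hGm hE k
  have hNN := integrable_gradNorm_mul hGm hE j k
  have hfun : (fun y => (Real.sqrt (∑ i : Fin 2, ((GB y (EuclideanSpace.single i (1:ℝ))) j) ^ 2) -
      Real.sqrt (∑ i : Fin 2, ((GB y (EuclideanSpace.single i (1:ℝ))) k) ^ 2)) ^ 2) =
      fun y => (Real.sqrt (∑ i : Fin 2, ((GB y (EuclideanSpace.single i (1:ℝ))) j) ^ 2) ^ 2 +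
        Real.sqrt (∑ i : Fin 2, ((GB y (EuclideanSpace.single i (1:ℝ))) k) ^ 2) ^ 2) -
        2 * (Real.sqrt (∑ i : Fin 2, ((GB y (EuclideanSpace.single i (1:ℝ))) j) ^ 2) *
          Real.sqrt (∑ i : Fin 2, ((GB y (EuclideanSpace.single i (1:ℝ))) k) ^ 2)) := by
    funext y; ring
  have hint : Integrable (fun y => (Real.sqrt (∑ i : Fin 2, ((GB y (EuclideanSpace.single i (1:ℝ))) j) ^ 2) -
      Real.sqrt (∑ i : Fin 2, ((GB y (EuclideanSpace.single i (1:ℝ))) k) ^ 2)) ^ 2) := by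
    rw [hfun]; exact (hNj.add hNk).sub (hNN.const_mul 2)
  have hzero : ∫ y, (Real.sqrt (∑ i : Fin 2, ((GB y (EuclideanSpace.single i (1:ℝ))) j) ^ 2) -
      Real.sqrt (∑ i : Fin 2, ((GB y (EuclideanSpace.single i (1:ℝ))) k) ^ 2)) ^ 2 = 0 := by
    have hadd : Integrable (fun y => Real.sqrt (∑ i : Fin 2, ((GB y (EuclideanSpace.single i (1:ℝ))) j) ^ 2) ^ 2 +
        Real.sqrt (∑ i : Fin 2, ((GB y (EuclideanSpace.single i (1:ℝ))) k) ^ 2) ^ 2) := hNj.add hNk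
    have h2 : Integrable (fun y => 2 * (Real.sqrt (∑ i : Fin 2, ((GB y (EuclideanSpace.single i (1:ℝ))) j) ^ 2) *
        Real.sqrt (∑ i : Fin 2, ((GB y (EuclideanSpace.single i (1:ℝ))) k) ^ 2))) := hNN.const_mul 2
    rw [hfun, integral_sub hadd h2, integral_add hNj hNk, integral_const_mul, h]
    have ej : ∫ y, Real.sqrt (∑ i : Fin 2, ((GB y (EuclideanSpace.single i (1:ℝ))) j) ^ 2) ^ 2 = t := by
      simpa only [hsq] using hj
    have ek : ∫ y, Real.sqrt (∑ i : Fin 2, ((GB y (EuclideanSpace.single i (1:ℝ))) k) ^ 2) ^ 2 = t := by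
      simpa only [hsq] using hk
    rw [ej, ek]; ring
  have hnn : 0 ≤ᵐ[volume] fun y => (Real.sqrt (∑ i : Fin 2, ((GB y (EuclideanSpace.single i (1:ℝ))) j) ^ 2) -
      Real.sqrt (∑ i : Fin 2, ((GB y (EuclideanSpace.single i (1:ℝ))) k) ^ 2)) ^ 2 :=
    Eventually.of_forall fun y => sq_nonneg _
  have hae := (integral_eq_zero_iff_of_nonneg_ae hnn hint).mp hzero
  filter_upwards [hae] with y hy
  have hy' : (Real.sqrt (∑ i : Fin 2, ((GB y (EuclideanSpace.single i (1:ℝ))) j) ^ 2) -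
      Real.sqrt (∑ i : Fin 2, ((GB y (EuclideanSpace.single i (1:ℝ))) k) ^ 2)) ^ 2 = 0 := hy
  have := pow_eq_zero_iff (two_ne_zero) |>.mp hy'
  linarith

end Letters

end Summit.QuantumFields.YangMills.Theorems.PoincareLipschitzHSystemGapAlgebraLetters

end
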